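import Summits.SmoothPoincare4.SmoothPoincare4.Theorems.SullivanDualTargetOfSympcap
import Literature.Geometry.Symplectic.GromovR4StdModel
import Mathlib.Analysis.InnerProductSpace.Adjoint
import Mathlib.Analysis.InnerProductSpace.Spectrum

/-!
# Helper `helper_qrSegment` — an isometry `A` making the segment from `id` to `A ∘ L` invertible

Line `kaehler-jacket`, crux `SullivanDual.Target` (stmt-SmoothPoincare4-7823), wave 2
(converse certificate "chart-form diffeomorphism ⇒ star-collared jacket").

**Claim (`helper_qrSegment`).** For every injective (continuous) linear map `L : ℝ⁴ → ℝ⁴` there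
is a linear isometry `A : ℝ⁴ ≃ₗᵢ ℝ⁴` such that every member `M_t = (1 - t)·id + t·(A ∘ L)`,
`t ∈ [0, 1]`, of the straight segment from the identity to `A ∘ L` is injective. (The lead uses
it to join the differential `L` of a local diffeomorphism to an isometry through invertible
linear maps; the `O(4)`-twist `A` absorbs the handedness of the chart.)

**Construction and proof (polar decomposition via singular vectors).** Let `T = L† L` be the
Gram operator of `L`; it is symmetric (`LinearMap.isSymmetric_adjoint_mul_self`), so the spectral
theorem (`LinearMap.IsSymmetric.eigenvectorBasis`) provides an orthonormal basis `b₀, …, b₃` of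
`ℝ⁴` of eigenvectors of `T`. The images `L bᵢ` are pairwise orthogonal,
`⟪L bᵢ, L bⱼ⟫ = ⟪T bᵢ, bⱼ⟫ = λᵢ ⟪bᵢ, bⱼ⟫ = 0` for `i ≠ j`
(`exists_orthonormalBasis_inner_map_eq_zero`), and nonzero because `L` is injective, so
`cᵢ = L bᵢ / ‖L bᵢ‖` is a second orthonormal basis of `ℝ⁴`. Let `A` be the linear isometry with
`A cᵢ = bᵢ` (composition of the two coordinate isometries `ℝ⁴ ≃ₗᵢ EuclideanSpace ℝ (Fin 4)`).
Then `A (L bᵢ) = μᵢ bᵢ` with `μᵢ = ‖L bᵢ‖ > 0` (`exists_linearIsometryEquiv_map_basis`): `A ∘ L`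
is the positive factor `P` of the polar decomposition `L = A⁻¹ P`. For `t ∈ [0, 1]` the segment
member satisfies `M_t bᵢ = ((1 - t) + t μᵢ) bᵢ` with `(1 - t) + t μᵢ > 0`, so the range of `M_t`
contains the basis `b`; thus `M_t` is surjective, and a surjective linear endomorphism of a
finite-dimensional space is injective (`LinearMap.injective_iff_surjective`).

References: the polar decomposition / singular value decomposition of a real matrix is standard
linear algebra (e.g. R. A. Horn, C. R. Johnson, *Matrix Analysis*, 2nd ed. (2013), Thm. 7.3.1);
the spectral theorem and rank–nullity used here are Mathlib's. What is NOT here: smoothness in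
`t`, or any statement about `GL⁺`; only injectivity of each segment member is proved.
-/

noncomputable section

-- the prescribed namespace `Summit.<P>.<Sub>.…` duplicates `SmoothPoincare4` (P = Sub)
set_option linter.dupNamespace false

open scoped Manifold ContDiff Topology InnerProductSpace
open Set Function
open Literature.Geometry.Kaehler (MForm IsSmoothForm IsClosedForm mextDeriv)
open Literature.Geometry.Symplectic (punctured InPuncturedChartBall stdSymplecticForm inversion
  invertedStdForm IsSymplecticStandardNearPoint AgreesWithInvertedChartNear)
open Literature.Topology.FourManifolds (HomotopySphere)

namespace Summit.SmoothPoincare4.SmoothPoincare4.Theorems.Target.KaehlerJacket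

/-- Model space `ℝ⁴`. -/
local notation "E4" => EuclideanSpace ℝ (Fin 4)

/-- **Singular vectors.** For every continuous linear map `L : ℝ⁴ → ℝ⁴` there is an orthonormal
basis `b` of `ℝ⁴` whose images `L (b i)` are pairwise orthogonal: take an orthonormal eigenbasis
of the symmetric Gram operator `T = L† L` (spectral theorem); then
`⟪L (b i), L (b j)⟫ = ⟪T (b i), b j⟫ = λᵢ ⟪b i, b j⟫ = 0` for `i ≠ j`. [folklore] -/
theorem exists_orthonormalBasis_inner_map_eq_zero (L : E4 →L[ℝ] E4) :
    ∃ b : OrthonormalBasis (Fin 4) ℝ E4, ∀ i j, i ≠ j → ⟪L (b i), L (b j)⟫_ℝ = 0 := by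
  classical
  set L' : E4 →ₗ[ℝ] E4 := (L : E4 →ₗ[ℝ] E4)
  have hT : (L'.adjoint * L').IsSymmetric := LinearMap.isSymmetric_adjoint_mul_self L'
  have hn : Module.finrank ℝ E4 = 4 := finrank_euclideanSpace_fin
  refine ⟨hT.eigenvectorBasis hn, fun i j hij => ?_⟩
  have h1 : ⟪L (hT.eigenvectorBasis hn i), L (hT.eigenvectorBasis hn j)⟫_ℝ =
      ⟪(L'.adjoint * L') (hT.eigenvectorBasis hn i), hT.eigenvectorBasis hn j⟫_ℝ := by
    rw [Module.End.mul_apply, LinearMap.adjoint_inner_left]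
    rfl
  rw [h1, hT.apply_eigenvectorBasis hn i, real_inner_smul_left,
    (hT.eigenvectorBasis hn).inner_eq_zero hij, mul_zero]

/-- **Polar normalisation by an isometry.** For an injective continuous linear map
`L : ℝ⁴ → ℝ⁴` there are an orthonormal basis `b` of `ℝ⁴` and a linear isometry `A` of `ℝ⁴` with
`A (L (b i)) = ‖L (b i)‖ • b i` and `0 < ‖L (b i)‖` for every `i`; i.e. `A ∘ L` is diagonal with
positive entries in the orthonormal basis `b` (the positive polar factor of `L`). Construction:
`b` from `exists_orthonormalBasis_inner_map_eq_zero`, `c i = ‖L (b i)‖⁻¹ • L (b i)` is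
orthonormal, and `A` is the isometry sending the orthonormal basis `c` to `b`. [folklore] -/
theorem exists_linearIsometryEquiv_map_basis (L : E4 →L[ℝ] E4) (hL : Injective L) :
    ∃ (b : OrthonormalBasis (Fin 4) ℝ E4) (A : E4 ≃ₗᵢ[ℝ] E4),
      ∀ i, A (L (b i)) = ‖L (b i)‖ • b i ∧ 0 < ‖L (b i)‖ := by
  classical
  obtain ⟨b, hb⟩ := exists_orthonormalBasis_inner_map_eq_zero L
  have hne : ∀ i, L (b i) ≠ 0 := fun i h =>
    b.orthonormal.ne_zero i (hL (h.trans (map_zero L).symm))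
  have hpos : ∀ i, 0 < ‖L (b i)‖ := fun i => norm_pos_iff.2 (hne i)
  set c : Fin 4 → E4 := fun i => ‖L (b i)‖⁻¹ • L (b i) with hc_def
  have hc : Orthonormal ℝ c := by
    refine ⟨fun i => ?_, fun i j hij => ?_⟩
    · show ‖‖L (b i)‖⁻¹ • L (b i)‖ = 1
      rw [norm_smul, norm_inv, norm_norm, inv_mul_cancel₀ (hpos i).ne']
    · show ⟪‖L (b i)‖⁻¹ • L (b i), ‖L (b j)‖⁻¹ • L (b j)⟫_ℝ = 0
      rw [real_inner_smul_left, real_inner_smul_right, hb i j hij, mul_zero, mul_zero]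
  have hcard : Fintype.card (Fin 4) = Module.finrank ℝ E4 := by
    rw [Fintype.card_fin, finrank_euclideanSpace_fin]
  set cB : OrthonormalBasis (Fin 4) ℝ E4 :=
    (basisOfOrthonormalOfCardEqFinrank hc hcard).toOrthonormalBasis
      (by rw [coe_basisOfOrthonormalOfCardEqFinrank]; exact hc) with hcB_def
  have hcB : ∀ i, cB i = c i := fun i => by
    rw [hcB_def, Module.Basis.coe_toOrthonormalBasis, coe_basisOfOrthonormalOfCardEqFinrank]
  refine ⟨b, cB.repr.trans b.repr.symm, fun i => ⟨?_, hpos i⟩⟩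
  have hLb : L (b i) = ‖L (b i)‖ • cB i := by
    rw [hcB, hc_def]
    dsimp only
    rw [smul_smul, mul_inv_cancel₀ (hpos i).ne', one_smul]
  have key : (cB.repr.trans b.repr.symm) (‖L (b i)‖ • cB i) = ‖L (b i)‖ • b i := by
    rw [LinearIsometryEquiv.map_smul, LinearIsometryEquiv.trans_apply, cB.repr_self,
      b.repr_symm_single]
  exact (congrArg (cB.repr.trans b.repr.symm) hLb).trans key

/-- **Helper `helper_qrSegment`.** For every injective continuous linear map `L : ℝ⁴ → ℝ⁴`
there is a linear isometry `A` of `ℝ⁴` such that, for every `t ∈ [0, 1]`, the segment member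
`(1 - t)·id + t·(A ∘ L)` is injective. Proof: with `b`, `A` from
`exists_linearIsometryEquiv_map_basis`, the segment member maps `b i` to
`((1 - t) + t ‖L (b i)‖) • b i` with a positive coefficient, hence is surjective (its range
contains the basis `b`), hence injective (finite dimension). [folklore] -/
theorem helper_qrSegment :
    ∀ (L : E4 →L[ℝ] E4), Injective L →
      ∃ A : E4 ≃ₗᵢ[ℝ] E4, ∀ t : ℝ, 0 ≤ t → t ≤ 1 →
        Injective ((1 - t) • ContinuousLinearMap.id ℝ E4 +
          t • ((A.toContinuousLinearEquiv : E4 →L[ℝ] E4).comp L)) := by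
  intro L hL
  obtain ⟨b, A, hA⟩ := exists_linearIsometryEquiv_map_basis L hL
  refine ⟨A, fun t ht0 ht1 => ?_⟩
  set F : E4 →L[ℝ] E4 := (1 - t) • ContinuousLinearMap.id ℝ E4 +
    t • ((A.toContinuousLinearEquiv : E4 →L[ℝ] E4).comp L) with hF_def
  have hcoef : ∀ i, 0 < (1 - t) + t * ‖L (b i)‖ := fun i => by
    rcases ht0.eq_or_lt with h | h
    · rw [← h]
      norm_num
    · have := mul_pos h (hA i).2
      linarith [sub_nonneg.2 ht1]
  have hF : ∀ i, F (b i) = ((1 - t) + t * ‖L (b i)‖) • b i := fun i => by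
    rw [hF_def, add_apply, smul_apply, smul_apply, ContinuousLinearMap.id_apply,
      ContinuousLinearMap.comp_apply, ContinuousLinearEquiv.coe_coe,
      LinearIsometryEquiv.coe_toContinuousLinearEquiv, (hA i).1, smul_smul, ← add_smul]
  have hsurj : Surjective F := by
    intro y
    refine ⟨∑ i, (b.repr y i / ((1 - t) + t * ‖L (b i)‖)) • b i, ?_⟩
    simp only [map_sum, map_smul, hF, smul_smul]
    conv_rhs => rw [← b.sum_repr y]
    refine Finset.sum_congr rfl fun i _ => ?_
    rw [div_mul_cancel₀ _ (hcoef i).ne']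
  exact (LinearMap.injective_iff_surjective (f := (F : E4 →ₗ[ℝ] E4))).2 hsurj

end Summit.SmoothPoincare4.SmoothPoincare4.Theorems.Target.KaehlerJacket

end
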